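import Summits.Langlands.Langlands.Theses.SplitPrimeExitCarving

/-!
# `SplitPrimeExitCarving` — kernel twin, PART 1 (exactness + necessity + root), on the BORN route

Tree twin (census-1 g24, lens-6-g22 OFFER (3)) of the node `HOME/nodes/lens-6-g22-SplitPrimeExitCarving.SplitPrimeExitCarving.lean`
(sha256 aa84bd28f4df…, crit-1 g6 CLEARED row 263) AFTER the birth of route-Langlands-SplitPrimeExitCarving rev 0 (@26f261997fec, the 71st
cell route; `--refines route-Langlands-SkinnerWilesDefectOne:ProModularOrdinaryClassical`, stmt-Langlands-12921 = the EXIT of the LIVE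
route `SkinnerWilesDefectOne`, D-0179 blocker): the three cells are now the ROUTE DECLS `SplitPrimeExit` (stmt-Langlands-27471),
`RamifiedPrimeExit` (27472), `InertPrimeExit` (27473) and are used BY NAME — nothing is restated.

What is here (sorry-free, axioms `propext`, `Classical.choice`, `Quot.sound`):
* `exit_iff_cells : EXIT ↔ SplitPrimeExit ∧ RamifiedPrimeExit ∧ InertPrimeExit` — the EXACTNESS certificate of the cut (two pointwise
  excluded middles on the dial «splitting type of `p` in the imaginary quadratic `F`», typed by ideal membership only); the `←`
  direction is the route's deciding theorem `Theses.SplitPrimeExitCarving.closes` (= node `closes_child`), re-proved here verbatim;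
* `split_of_exit` / `ramified_of_exit` / `inert_of_exit` — each cell is WEAKER than the exit (necessity);
* `langlands_of_cells` — ROOT: the cells + the host's ENGINE `ReducibleOrdinaryProModular` (12919) + the host's declared residual
  `SectorComplement` (12923) give `Langlands` through the host route's landed deciding theorem `SkinnerWilesDefectOne.closes`.
PART 2 (the X-level seam `ordinaryFactorisation_iff_cells` / `seam_at` / `*_of_seam` against the anchored inputs KT slope-zero p98105 and
Hida-tower finiteness p112149 ∘ 15362) waits for the out-of-cone modules (`SlopeZeroFactorisation`, `OfBianchiFinitenessHidaFinite`,
`Cruxes/ProModularOrdinaryClassical/Split`) to build on the farm, as the node's `anchors.lean` records.  Nothing here proves `Langlands`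
or the EXIT.
-/

set_option linter.dupNamespace false -- project-wide option; `Summit.Langlands.Langlands` is the mandated namespace

namespace Summit.Langlands.Langlands.Theorems.SplitPrimeExit

open Summit.Langlands.Langlands.Theses.SplitPrimeExitCarving (SplitPrimeExit RamifiedPrimeExit InertPrimeExit)

/-! ## Kernel: EXACT mod NOTHING -/

/-- **EXIT ⟺ Split ∧ Ramified ∧ Inert** — two pointwise excluded middles on the dial texts. [folklore] -/
theorem exit_iff_cells :
    Summit.Langlands.Langlands.Theses.SkinnerWilesDefectOne.ProModularOrdinaryClassical ↔ (SplitPrimeExit ∧ RamifiedPrimeExit ∧ InertPrimeExit) := by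
  constructor
  · intro h
    exact ⟨fun F _ _ hF hdeg p _ hp _ => h F hF hdeg p hp,
      fun F _ _ hF hdeg p _ hp _ _ => h F hF hdeg p hp,
      fun F _ _ hF hdeg p _ hp _ _ => h F hF hdeg p hp⟩
  · rintro ⟨hA, hC, hB⟩ F _ _ hF hdeg p _ hp
    by_cases hs : (∃ v w : IsDedekindDomain.HeightOneSpectrum (NumberField.RingOfIntegers F), v ≠ w ∧ (p : NumberField.RingOfIntegers F) ∈ v.asIdeal ∧ (p : NumberField.RingOfIntegers F) ∈ w.asIdeal)
    · exact hA F hF hdeg p hp hs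
    · by_cases hr : (∃ v : IsDedekindDomain.HeightOneSpectrum (NumberField.RingOfIntegers F), (p : NumberField.RingOfIntegers F) ∈ v.asIdeal ^ 2)
      · exact hC F hF hdeg p hp hs hr
      · exact hB F hF hdeg p hp hs hr

/-! ## Necessity: each cell is WEAKER than the exit -/

/-- cell SPLIT is WEAKER than the exit. [folklore] -/
theorem split_of_exit (h : Summit.Langlands.Langlands.Theses.SkinnerWilesDefectOne.ProModularOrdinaryClassical) : SplitPrimeExit := (exit_iff_cells.1 h).1
/-- cell RAMIFIED is WEAKER than the exit. [folklore] -/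
theorem ramified_of_exit (h : Summit.Langlands.Langlands.Theses.SkinnerWilesDefectOne.ProModularOrdinaryClassical) : RamifiedPrimeExit := (exit_iff_cells.1 h).2.1
/-- cell INERT is WEAKER than the exit. [folklore] -/
theorem inert_of_exit (h : Summit.Langlands.Langlands.Theses.SkinnerWilesDefectOne.ProModularOrdinaryClassical) : InertPrimeExit := (exit_iff_cells.1 h).2.2

/-! ## Root -/

/-- **ROOT**: the cells, the host's ENGINE (stmt-Langlands-12919) and the host's declared residual `SectorComplement` give `Langlands`,
through the host route's landed deciding theorem `SkinnerWilesDefectOne.closes`. [folklore] -/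
theorem langlands_of_cells (hA : SplitPrimeExit) (hC : RamifiedPrimeExit) (hB : InertPrimeExit)
    (hE : Summit.Langlands.Langlands.Theses.SkinnerWilesDefectOne.ReducibleOrdinaryProModular) (hS : Summit.Langlands.Langlands.Theses.SkinnerWilesDefectOne.SectorComplement) : _root_.Langlands :=
  Summit.Langlands.Langlands.Theses.SkinnerWilesDefectOne.closes hE (Summit.Langlands.Langlands.Theses.SplitPrimeExitCarving.closes hA hC hB) hS

end Summit.Langlands.Langlands.Theorems.SplitPrimeExit
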